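import Literature.Probability.Percolation.LatticeWalksGM
import Literature.Probability.Percolation.StarTriangleWalks
import Literature.Probability.LatticeModels.ProdBernoulliThinning
import HarnessLib

/-!
# The strip of `TrackExchangeStrip` read off `ℤ²`: the dictionary

Grimmett–Manolescu, *Bond percolation on isoradial graphs* (PTRF 159 (2014) 273–327 =
arXiv:1204.0505), §4.6 and §6. The transport files work on the strip model `TrackExchangeStrip`
(labels `SV = Option (ℤ × ℤ)`, weights `canonicalWeight`); the isoradial square lattice of the
tree is the abstract `ℤ²` (`Site 2`, `zdGraph 2`) with the product measure
`prodBernoulli (gmWeight α rows)` (`IsoradialSquareLatticeGM`, §4.6). This file is the dictionary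
between the two (split off `HorizontalTransportGM` so that both transports can use it):

* `toStrip M ω` — the configuration of the strip read off a configuration `ω` of `ℤ²` (the edge
  `e` of `ℤ²` with both endpoints of column in `[-M, M)` is the coordinate `labelMap e` of the
  strip); `map_toStrip` — under `P_{α,rows}` it has the strip's canonical measure
  (`prodBernoulli_map_thin`, `prodBernoulli_map_compl`);
* walks: `isWalk_map_gmLabel` (an open lattice walk inside the strip reads off as an open walk of
  the strip), `isLatticeWalk_map_siteOf` and `even_of_mem_of_isWalk` (an open walk of the strip
  avoiding `⋆` lifts to an open lattice walk; its labels are primal), `adj_of_mem_toStrip`.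

## References

* G. R. Grimmett, I. Manolescu, PTRF 159 (2014) 273–327, arXiv:1204.0505, §4.6 (`G_{α,β}`,
  `P_{α,β}`), §6.1.
-/

noncomputable section

namespace Literature.Probability.Percolation

open LatticeModels StarTriangle Real MeasureTheory

namespace TrackExchange

/-! ### The dictionary on configurations -/

/-- `gmLabel` is injective. [folklore] -/
theorem gmLabel_injective : Function.Injective gmLabel := by
  intro x y h
  simp only [gmLabel, Option.some.injEq, Prod.mk.injEq] at h
  funext k
  fin_cases k <;> simp <;> omega

/-- The dictionary on unordered pairs. [folklore] -/
def labelMap : Sym2 (Site 2) → Sym2 SV := Sym2.map gmLabel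

/-- The dictionary on pairs is injective. [folklore] -/
theorem labelMap_injective : Function.Injective labelMap := Sym2.map.injective gmLabel_injective

/-- The edges of `ℤ²` whose column lies in the strip `-M ≤ i < M`. [folklore] -/
def stripPairs (M : ℕ) : Set (Sym2 (Site 2)) :=
  {e | e ∈ (zdGraph 2).edgeSet ∧ -(M : ℤ) ≤ columnIndex e ∧ columnIndex e < M}

/-- **Reading a configuration of `ℤ²` on the strip**: the labelled images of its open edges of
the columns `-M ≤ i < M`. [folklore] -/
def toStrip (M : ℕ) (ω : Set (Sym2 (Site 2))) : Set (Sym2 SV) := labelMap '' (ω ∩ stripPairs M)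

/-- Membership in the read-off configuration. [folklore] -/
theorem mem_toStrip_iff {M : ℕ} {ω : Set (Sym2 (Site 2))} {j : Sym2 SV} :
    j ∈ toStrip M ω ↔ ∃ e, e ∈ ω ∧ e ∈ stripPairs M ∧ labelMap e = j := by
  simp only [toStrip, Set.mem_image, Set.mem_inter_iff]
  constructor
  · rintro ⟨e, ⟨h1, h2⟩, h3⟩; exact ⟨e, h1, h2, h3⟩
  · rintro ⟨e, h1, h2, h3⟩; exact ⟨e, ⟨h1, h2⟩, h3⟩

/-- The labelled strip pairs. [folklore] -/
def stripLabels (M : ℕ) : Set (Sym2 SV) := labelMap '' stripPairs M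

/-- The preimage of a labelled strip pair. [folklore] -/
def unlabel (M : ℕ) (j : stripLabels M) : Sym2 (Site 2) := j.2.choose

/-- `unlabel` inverts `labelMap` on the strip. [folklore] -/
theorem unlabel_spec (M : ℕ) (j : stripLabels M) : unlabel M j ∈ stripPairs M ∧ labelMap (unlabel M j) = j :=
  j.2.choose_spec

/-- `unlabel` of a labelled strip pair. [folklore] -/
theorem unlabel_labelMap {M : ℕ} {e : Sym2 (Site 2)} (he : e ∈ stripPairs M) :
    unlabel M ⟨labelMap e, e, he, rfl⟩ = e :=
  labelMap_injective (unlabel_spec M ⟨labelMap e, e, he, rfl⟩).2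

/-- `unlabel` is injective. [folklore] -/
theorem unlabel_injective (M : ℕ) : Function.Injective (unlabel M) := by
  intro j j' h
  apply Subtype.ext
  rw [← (unlabel_spec M j).2, ← (unlabel_spec M j').2, h]

/-- The read-off configuration is a thinning of the complement. [folklore] -/
theorem toStrip_eq_thinMap (M : ℕ) (ω : Set (Sym2 (Site 2))) :
    toStrip M ω = thinMap (stripLabels M) (unlabel M) ωᶜ := by
  ext j
  rw [mem_toStrip_iff, mem_thinMap_iff]
  constructor
  · rintro ⟨e, heω, hes, rfl⟩
    refine ⟨⟨e, hes, rfl⟩, ?_⟩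
    rw [Set.mem_compl_iff, not_not, unlabel_labelMap hes]
    exact heω
  · rintro ⟨hj, he⟩
    rw [Set.mem_compl_iff, not_not] at he
    exact ⟨unlabel M ⟨j, hj⟩, he, (unlabel_spec M ⟨j, hj⟩).1, (unlabel_spec M ⟨j, hj⟩).2⟩

/-- Reading off the strip is measurable. [folklore] -/
theorem measurable_toStrip (M : ℕ) : Measurable (toStrip M) := by
  have h : toStrip M = thinMap (stripLabels M) (unlabel M) ∘ compl := by
    funext ω; exact toStrip_eq_thinMap M ω
  rw [h]
  exact (measurable_thinMap _ _).comp (measurable_set_iff.2 fun i => (measurable_set_mem i).not)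

/-- **The support of the strip weights**: a pair of positive canonical weight is the labelled
image of a pair of `ℤ²` in the strip. [folklore] -/
theorem exists_labelMap_eq_of_canonicalWeight_ne_zero (M : ℕ) (Θ : ℤ → ℤ → ℝ) {j : Sym2 SV}
    (hj : canonicalWeight M Θ j ≠ 0) : ∃ e ∈ stripPairs M, labelMap e = j := by
  -- a pair `some a, some b` with a nonzero directed weight in one of the two orders
  have key : ∀ a b : ℤ × ℤ, dirWeight M Θ (some a) (some b) ≠ 0 →
      ∃ e ∈ stripPairs M, labelMap e = s(some a, some b) := by
    intro a b h
    simp only [dirWeight] at h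
    split_ifs at h with h1 h2
    · -- the even diagonal `(i,y)–(i+1,y+1)`: a horizontal edge
      obtain ⟨hb, ⟨r, hr⟩, hi, hi'⟩ := h1
      set x : Site 2 := ![r, r - a.1] with hx
      have hx0 : x 0 = r := rfl
      have hx1 : x 1 = r - a.1 := rfl
      refine ⟨s(x, x + Pi.single 0 1), ⟨(SimpleGraph.mem_edgeSet _).2 ((zdGraph_adj_iff _ _).2 ⟨0, Or.inl rfl⟩), ?_⟩, ?_⟩
      · show -(M : ℤ) ≤ columnIndex s(x, x + Pi.single 0 1) ∧ columnIndex s(x, x + Pi.single 0 1) < M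
        rw [columnIndex_horizontal, hx0, hx1]; constructor <;> omega
      · have hxa : gmLabel x = some a := by
          simp only [gmLabel, hx0, hx1]
          exact congrArg some (Prod.ext (show r - (r - a.1) = a.1 by omega) (show r + (r - a.1) = a.2 by omega))
        have hxb : gmLabel (x + Pi.single 0 1) = some b := by
          rw [gmLabel_add_single_zero, hx0, hx1, hb]
          exact congrArg some (Prod.ext (show r - (r - a.1) + 1 = a.1 + 1 by omega) (show r + (r - a.1) + 1 = a.2 + 1 by omega))
        simp only [labelMap, Sym2.map_mk, hxa, hxb]
    · -- the odd diagonal `(i,y'+1)–(i+1,y')`: a vertical edge, read from `b`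
      obtain ⟨hb, hodd, hi, hi'⟩ := h2
      have hev : Even (a.1 + a.2) := by
        rcases Int.even_or_odd (a.1 + a.2) with h' | ⟨r, hr⟩
        · exact h'
        · exact absurd ⟨r, by omega⟩ hodd
      obtain ⟨r, hr⟩ := hev
      set x : Site 2 := ![r, r - (a.1 + 1)] with hx
      have hx0 : x 0 = r := rfl
      have hx1 : x 1 = r - (a.1 + 1) := rfl
      refine ⟨s(x, x + Pi.single 1 1), ⟨(SimpleGraph.mem_edgeSet _).2 ((zdGraph_adj_iff _ _).2 ⟨1, Or.inl rfl⟩), ?_⟩, ?_⟩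
      · show -(M : ℤ) ≤ columnIndex s(x, x + Pi.single 1 1) ∧ columnIndex s(x, x + Pi.single 1 1) < M
        rw [columnIndex_vertical, hx0, hx1]; constructor <;> omega
      · have hxb : gmLabel x = some b := by
          simp only [gmLabel, hx0, hx1, hb]
          exact congrArg some (Prod.ext (show r - (r - (a.1 + 1)) = a.1 + 1 by omega)
            (show r + (r - (a.1 + 1)) = a.2 - 1 by omega))
        have hxa : gmLabel (x + Pi.single 1 1) = some a := by
          rw [gmLabel_add_single_one, hx0, hx1]
          exact congrArg some (Prod.ext (show r - (r - (a.1 + 1)) - 1 = a.1 by omega)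
            (show r + (r - (a.1 + 1)) + 1 = a.2 by omega))
        simp only [labelMap, Sym2.map_mk, hxa, hxb]
        exact Sym2.eq_swap
    · exact absurd rfl h
  induction j using Sym2.ind with
  | _ u v =>
    rw [canonicalWeight_mk] at hj
    rcases u with _ | a <;> rcases v with _ | b
    · simp at hj
    · simp at hj
    · simp at hj
    · by_cases h1 : dirWeight M Θ (some a) (some b) ≠ 0
      · exact key a b h1
      · push Not at h1
        rw [h1] at hj
        have h2 : dirWeight M Θ (some b) (some a) ≠ 0 := by
          intro h2; rw [h2] at hj; exact hj (max_self _)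
        obtain ⟨e, he, hle⟩ := key b a h2
        exact ⟨e, he, hle.trans Sym2.eq_swap⟩

/-- **The law of the read-off configuration**: under `P_{α,rows}` on `ℤ²`, the configuration of
the strip has the strip's canonical measure. [cite: GrimmettManolescu2014Isoradial, §4.6] -/
theorem map_toStrip (M : ℕ) (α rows : ℤ → ℝ) :
    (prodBernoulli (Percolation.gmWeight α rows)).map (toStrip M) =
      prodBernoulli (canonicalWeight M fun i y => rows y - α i) := by
  classical
  have h : toStrip M = thinMap (stripLabels M) (unlabel M) ∘ compl := by
    funext ω; exact toStrip_eq_thinMap M ω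
  have hm : Measurable (compl : Set (Sym2 (Site 2)) → Set (Sym2 (Site 2))) :=
    measurable_set_iff.2 fun i => (measurable_set_mem i).not
  rw [h, ← Measure.map_map (measurable_thinMap _ _) hm, prodBernoulli_map_compl,
    prodBernoulli_map_thin (unlabel_injective M)]
  congr 1
  funext j
  unfold thinParam
  split_ifs with hj
  · rw [unitInterval.symm_symm]
    obtain ⟨e, he, hje⟩ := id hj
    subst hje
    rw [show unlabel M ⟨labelMap e, hj⟩ = e from unlabel_labelMap he]
    unfold labelMap
    rw [canonicalWeight_map_gmLabel, if_pos he.2]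
  · by_contra hne
    exact hj (exists_labelMap_eq_of_canonicalWeight_ne_zero M _ (Ne.symm hne))

/-! ### Walks of `ℤ²` and walks of the strip -/

/-- The label of a site, unfolded. [folklore] -/
theorem gmLabel_eq (x : Site 2) : gmLabel x = some (col x, hgtOf x) := rfl

/-- An edge of `ℤ²` between sites of columns in `(-M, M-1)` lies in the strip. [folklore] -/
theorem mem_stripPairs_of_adj {M : ℕ} {a b : Site 2} (hab : (zdGraph 2).Adj a b)
    (ha : -(M : ℤ) < col a) (ha' : col a < M) (hb : -(M : ℤ) < col b) : s(a, b) ∈ stripPairs M := by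
  refine ⟨(SimpleGraph.mem_edgeSet _).2 hab, ?_⟩
  show -(M : ℤ) ≤ columnIndex s(a, b) ∧ columnIndex s(a, b) < M
  rw [columnIndex_mk]
  simp only [col] at *
  constructor
  · exact le_min (by omega) (by omega)
  · exact (min_le_left _ _).trans_lt (by omega)

/-- **An open lattice walk inside the strip reads off as an open walk of the strip.** [folklore] -/
theorem isWalk_map_gmLabel {M : ℕ} {ω : Set (Sym2 (Site 2))} :
    ∀ {L : List (Site 2)}, IsLatticeWalk ω L → (∀ x ∈ L, -(M : ℤ) < col x ∧ col x < M) →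
      IsWalk (toStrip M ω) (L.map gmLabel)
  | [], _, _ => trivial
  | [_], _, _ => trivial
  | a :: b :: l, hL, hcol => by
    have ha := hcol a (by simp)
    have hb := hcol b (by simp)
    refine ⟨?_, isWalk_map_gmLabel hL.2 fun x hx => hcol x (List.mem_cons_of_mem _ hx)⟩
    rw [mem_toStrip_iff]
    exact ⟨s(a, b), hL.1.2, mem_stripPairs_of_adj hL.1.1 ha.1 ha.2 hb.1, rfl⟩

/-- The site with a given primal label. [folklore] -/
def unlabelSite (z : ℤ × ℤ) : Site 2 := ![(z.1 + z.2) / 2, (z.2 - z.1) / 2]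

/-- `unlabelSite` inverts `gmLabel` on primal labels. [folklore] -/
theorem gmLabel_unlabelSite {m y : ℤ} (h : Even (m + y)) : gmLabel (unlabelSite (m, y)) = some (m, y) := by
  obtain ⟨r, hr⟩ := h
  simp only [gmLabel, unlabelSite, Matrix.cons_val_zero, Matrix.cons_val_one, Option.some.injEq,
    Prod.mk.injEq]
  constructor <;> omega

/-- `unlabelSite ∘ gmLabel = id`. [folklore] -/
theorem unlabelSite_gmLabel (x : Site 2) : unlabelSite (col x, hgtOf x) = x := by
  apply gmLabel_injective
  rw [gmLabel_unlabelSite ⟨x 0, by simp only [col, hgtOf]; ring⟩, gmLabel_eq]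

/-- On primal labels `unlabelSite` has the prescribed column and height. [folklore] -/
theorem col_hgtOf_unlabelSite {m y : ℤ} (h : Even (m + y)) :
    col (unlabelSite (m, y)) = m ∧ hgtOf (unlabelSite (m, y)) = y := by
  have h1 := gmLabel_unlabelSite h
  rw [gmLabel_eq] at h1
  simpa using h1

/-- **An edge of the read-off configuration comes from an open edge of `ℤ²`** between the
unlabelled sites, which are primal labels. [folklore] -/
theorem adj_of_mem_toStrip {M : ℕ} {ω : Set (Sym2 (Site 2))} {m y m' y' : ℤ}
    (h : s((some (m, y) : SV), some (m', y')) ∈ toStrip M ω) :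
    Even (m + y) ∧ Even (m' + y') ∧ (zdGraph 2).Adj (unlabelSite (m, y)) (unlabelSite (m', y')) ∧
      s(unlabelSite (m, y), unlabelSite (m', y')) ∈ ω := by
  rw [mem_toStrip_iff] at h
  obtain ⟨e, heω, hes, hle⟩ := h
  induction e using Sym2.ind with
  | _ a b =>
    have hadj : (zdGraph 2).Adj a b := (SimpleGraph.mem_edgeSet _).1 hes.1
    unfold labelMap at hle
    rw [Sym2.map_mk, gmLabel_eq, gmLabel_eq, Sym2.eq_iff] at hle
    simp only [Option.some.injEq, Prod.mk.injEq] at hle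
    have hpa : Even (col a + hgtOf a) := ⟨a 0, by simp only [col, hgtOf]; ring⟩
    have hpb : Even (col b + hgtOf b) := ⟨b 0, by simp only [col, hgtOf]; ring⟩
    rcases hle with ⟨⟨h1, h2⟩, ⟨h3, h4⟩⟩ | ⟨⟨h1, h2⟩, ⟨h3, h4⟩⟩
    · subst h1; subst h2; subst h3; subst h4
      rw [unlabelSite_gmLabel, unlabelSite_gmLabel]
      exact ⟨hpa, hpb, hadj, heω⟩
    · subst h1; subst h2; subst h3; subst h4
      rw [unlabelSite_gmLabel, unlabelSite_gmLabel]
      exact ⟨hpb, hpa, hadj.symm, by rw [Sym2.eq_swap]; exact heω⟩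

/-- The site of a label (`⋆ ↦ 0`, never used). [folklore] -/
def siteOf : SV → Site 2
  | some z => unlabelSite z
  | none => 0

/-- **An open walk of the strip lifts to an open lattice walk** when it avoids `⋆` and its labels
are primal. [folklore] -/
theorem isLatticeWalk_map_siteOf {M : ℕ} {ω : Set (Sym2 (Site 2))} :
    ∀ {W : List SV}, IsWalk (toStrip M ω) W → none ∉ W → IsLatticeWalk ω (W.map siteOf)
  | [], _, _ => trivial
  | [_], _, _ => trivial
  | u :: v :: l, hW, hn => by
    rcases u with _ | ⟨m, y⟩
    · exact absurd (by simp) hn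
    rcases v with _ | ⟨m', y'⟩
    · exact absurd (by simp) hn
    have h := adj_of_mem_toStrip hW.1
    exact ⟨⟨h.2.2.1, h.2.2.2⟩, isLatticeWalk_map_siteOf hW.2 fun h' => hn (List.mem_cons_of_mem _ h')⟩

/-- Labels of an open walk of the strip avoiding `⋆` with at least one edge are primal. [folklore] -/
theorem even_of_mem_of_isWalk {M : ℕ} {ω : Set (Sym2 (Site 2))} :
    ∀ {W : List SV}, IsWalk (toStrip M ω) W → none ∉ W → 2 ≤ W.length →
      ∀ m y, some (m, y) ∈ W → Even (m + y)
  | [], _, _, h => by simp at h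
  | [_], _, _, h => by simp at h
  | [u, v], hW, hn, _ => by
    intro m y hm
    rcases u with _ | ⟨m₁, y₁⟩
    · exact absurd (by simp) hn
    rcases v with _ | ⟨m₂, y₂⟩
    · exact absurd (by simp) hn
    have h := adj_of_mem_toStrip hW.1
    simp only [List.mem_cons, Option.some.injEq, Prod.mk.injEq, List.not_mem_nil, or_false] at hm
    rcases hm with ⟨rfl, rfl⟩ | ⟨rfl, rfl⟩
    · exact h.1
    · exact h.2.1
  | u :: v :: w :: l, hW, hn, _ => by
    intro m y hm
    rcases List.mem_cons.1 hm with rfl | hm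
    · rcases v with _ | ⟨m₂, y₂⟩
      · exact absurd (by simp) hn
      exact (adj_of_mem_toStrip hW.1).1
    · exact even_of_mem_of_isWalk hW.2 (fun h' => hn (List.mem_cons_of_mem _ h')) (by simp) m y hm

end TrackExchange

end Literature.Probability.Percolation
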